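import Summits.QuantumFields.YangMills.Theorems.UnitScaleTiltHalvingP1FlatPillar
import Summits.QuantumFields.YangMills.Theorems.UnitScaleTiltProp8ChartLocalityFlat
import Summits.QuantumFields.YangMills.Theorems.UnitScaleTiltProp8ChartDoubleBarBall
import Summits.QuantumFields.YangMills.Theorems.UnitScaleTiltProp8HalvingSize152Dictionary
import HarnessLib

/-!
# Route `UnitScaleTilt`, crux K1 child «MinimiserStabilityRegPr» (stmt-QuantumFields-19200), registered stub V2′ `stub_halvingStep` (v8∕v10 `BirthV10`) —
# **PILLAR P1♭: THE SUPPLIED ROWS AND THE TYPED RESIDUE** (★★OWNER ACK 35; supply map `P1FLAT-SUPPLY-MAP-w3g4.md` 95f9affa157603e1):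
# `P1FlatPillarAt` (✓ `HalvingP1FlatPillar`, the P1♭ text of record) FROM ITS CORE `∃ u A, (o) ∧ (i) ∧ (ii) ∧ (iii) ∧ (iv)` — the two remaining conjuncts
# (vi) «(160)♭ near size of the top chart datum» and (vii) «(155)♭ every chart datum is `O(ε₀)`» are DISCHARGED from landed suppliers

Cell `ym3-torus` (HUMAN RULING D-0037, YM ladder rung R3 — continuum SU(2) YM₃ on the torus is a RUNG, not the Clay problem), width seat `ym-ust-19200-w3` gen 4.
`--supports stmt-QuantumFields-19200 --as helper`; def-free, 0 sorry, standard axioms.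

WHY.  The pillar's ∃-body has seven conjuncts; five of them — (o) the D-P1 top normalisation, (i) `A ∈ 𝔰𝔲(2)`, (ii) the chart identity on the member,
(iii) the (1.36)♭ sizes, (iv) the (1.38)♭ Landau slice — are the CONTENT of [Balaban1985RegularSpaces] Thm 2 in the double-bar chart at background `1` (programme
row WANTED №g26-5 «Thm 2♭ on T³»; no supplier in the tree: lit's Thm 2 is typed only as named-fact `Prop`s over the one-sided average).  The other two FOLLOW:
* (vi) from (o) + (ii): the `k`-fold double-bar average at an interior top bond reads only the fine bonds under its two top blocks (✓`ChartLocalityFlat.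
  dbarIterU_congr_of_agree`), where (ii) makes `e^{iηA}` the gauge copy `u⁻¹Uu`; (o) makes that average the axial copy of the ℰp top average, whose `(1∕i)log` IS
  lit-balaban's datum `B27T` (`B27T_eq`, rfl), of size `≤ 6·dist·ε₁` by ✓`HalvingDatum160.norm_datum160_le` ([Balaban1985Variational] (160)) — on the top cube
  `dist ≤ ρ + M − 1` (`FlatCubeSequenceAligned.dist_le_of_mem_cubeFinM`), so the regime `12(ρ + M)ε₁ ≤ 1` suffices; constant `C₁ = 6`.
* (vii) from (iii)'s first member: the k-uniform sup letter of the ♭ chart on the `w 1`-ball (✓`ChartDoubleBarBall.chartLogFlat_hCd_sup_of_adm22`, radius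
  `R := (B₁ + 1)ε₀`, collar from `FlatCubeSequenceAdm.adm22_cubeSeqMT3`) gives `‖chartLogFlat η D A c‖ ≤ 8L(B₁ + 1)ε₀`; constant `C₂ = 8L(B₁ + 1)`.

WHAT THIS FILE PROVES (no definition, no sorry; `D := cubeSeqMT3 F n K x ρ S M hM`, `η = L^{−(K−n)}`):
* §1 `sideTouches_top_of_inOm` (a fine bond whose source lies in the top cube side-touches the member's pulled-back top domain), `expCfg_eq_gaugeCopy_of_chart`
  ((ii) read as `e^{iηA} = u⁻¹Uu` in `M₂(ℂ)ˣ` on such bonds), `dbarIterU_expCfg_eq_gaugeCopy_top` (locality: the top double-bar average of `e^{iηA}` at an interior top bond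
  IS that of `u⁻¹Uu`).
* §2 ★ `near160_of_core` — (vi) from (o) + (ii) (+ `U ∈ 𝔅_k(V)`, `PlaqSmall ε₁ V`, `12(ρ+M)ε₁ ≤ 1`): `‖chartLogFlat η D A c‖ ≤ 6ε₁(dist(c₋, Bᵏx) + 1)` at every
  interior top index bond.
* §3 ★ `far155_of_size152` — (vii) from (iii)₁ (+ `R′M ≤ S`, `2L ≤ R′M + 1`, `60800·((d+2)L)²·L·(B₁+1)ε₀ ≤ 1`): `‖chartLogFlat η D A c‖ ≤ 8L(B₁+1)ε₀` everywhere.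
* §4 ★★ **`p1FlatPillarAt_of_core`** — `P1FlatPillarAt F n K D x ε₀ ε₁ B₁ 6 (8L(B₁+1)) U` from the CORE `∃ u A, DP1Clause … u ∧ (i) ∧ (ii) ∧ (iii) ∧ (iv)` displayed
  VERBATIM (= WANTED №g26-5 as a typed hypothesis) and the inputs above.
HONEST SCOPE.  Bookkeeping over landed suppliers; the core (Thm 2♭) is a hypothesis.  NOT a claim about the stub, the crux, the rung or the mass gap.

References: T. Bałaban, CMP **102** (1985) 277–309 [Balaban1985Variational] (152)–(156) pp.301–302, (160) p.303; CMP **99** (1985) 75–102 [Balaban1985RegularSpaces]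
Thm 2 p.83, (1.36)–(1.38) p.82; CMP **102** (1985) 255–275 [Balaban1985UV3] (27)–(28) p.263.
-/

set_option autoImplicit false

noncomputable section

open scoped BigOperators Matrix.Norms.L2Operator

namespace Summit.QuantumFields.YangMills.Theorems.HalvingP1FlatPillarRows

open Literature.MathematicalPhysics.QuantumFieldTheory.Balaban1983to89
open Literature.MathematicalPhysics.QuantumFieldTheory.Balaban1983to89.T3ContinuumYM3Torus
open Literature.MathematicalPhysics.QuantumFieldTheory.Balaban1983to89.T3UnitLawDensityEML (ℰp)
open Literature.MathematicalPhysics.QuantumFieldTheory.Balaban1983to89.T3ConstrainedMinimiser (fibre)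
open Complex (I)
open NormedSpace (exp)
open B5Eq117TorusCarriers (Mk)
open B5Eq118OneStroke (iterBlockOf)
open B5Prop12FieldsLattice (distSite distSite_nonneg)
open B6SectADomainsV1 (Domains)
open B6SectAOperatorsV1 (BondIdx SiteIdx)
open B7Prop1Explicit (expUnit)
open B8Eq140Level (SideTouches sideTouches_of_bondTouches)
open B8Thm2SetupTorus (pullDom)
open B10Eq27TorusAxialLog (transl unitsField toUField gaugeActT gaugeActT_apply holT contourT B27T B27T_eq)
open B11Eq115Space (levOf)
open LatticeFieldCalculus (laplace diverg siteAvgIter)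
open MatrixLog (mlog)
open FlatCubeOpsText (IsLevWeight Adm22)
open FlatCubeSequenceAligned (cubeSeqMT3 cubeSeqM cubeSeqM_Om_pos dist_le_of_mem_cubeFinM radM)
open FlatCubeSequenceAdm (adm22_cubeSeqMT3)
open HalvingSliceDictionary (transl_zero_valLabels)
open HalvingP1FlatPillar (DP1Clause P1FlatPillarAt)
open Summit.QuantumFields.YangMills.Theorems.Prop8Chart (expCfg coe_expCfg)
open Summit.QuantumFields.YangMills.Theorems.Prop8ChartDoubleBar (dbarIterU chartLogFlat chartLogFlat_apply dbarIterU_congr_of_agree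
  chartLogFlat_hCd_sup_of_adm22)

variable {F : T3Family} {n K : ℕ}

/-! ## §1 The top double-bar average of the charted configuration is that of the gauge copy -/

section Locality

/-- **A FINE BOND WHOSE SOURCE LIES IN THE TOP CUBE SIDE-TOUCHES THE MEMBER'S PULLED-BACK TOP DOMAIN** (its source lies in it; `d = 3 ≥ 2` supplies the second
direction).  [cite: Balaban1985RegularSpaces, p.77 (convention before (1.5)), (1.3) p.77] -/
theorem sideTouches_top_of_inOm (D : Domains (F.P K)) {j : ℕ} (b : PBond (F.P K) 0) (hb : D.InOm j b.src) :
    SideTouches (pullDom (fun i => {y : Site (F.P K) 0 | D.InOm i y}) j) (fun ν => ((b.src ν).val : ℤ)) b.dir := by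
  obtain ⟨κ, hκ⟩ : ∃ κ : Fin (F.P K).d, κ ≠ b.dir := by
    haveI : Nontrivial (Fin (F.P K).d) := (inferInstance : Nontrivial (Fin 3))
    exact exists_ne b.dir
  refine sideTouches_of_bondTouches hκ (Or.inl ?_)
  show transl (0 : Site (F.P K) 0) (fun ν => ((b.src ν).val : ℤ)) ∈ {y : Site (F.P K) 0 | D.InOm j y}
  rw [transl_zero_valLabels]
  exact hb

/-- **(ii) READ IN `M₂(ℂ)ˣ`**: on a fine bond side-touching the member's level-`j` domain (`1 ≤ j ≤ K − n`) the charted configuration `e^{iηA}` IS the gauge copy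
`u(b₋)⁻¹·U(b)·u(b₊)`. [cite: Balaban1985Variational, (152) p.301] -/
theorem expCfg_eq_gaugeCopy_of_chart (D : Domains (F.P K)) {U : GaugeField (F.P K) 0 (Matrix.specialUnitaryGroup (Fin 2) ℂ)}
    {u : GaugeTransf (F.P K) 0 (Matrix.unitaryGroup (Fin 2) ℂ)} {A : PBond (F.P K) 0 → Matrix (Fin 2) (Fin 2) ℂ}
    (hchart : ∀ j, 1 ≤ j → j ≤ K - n → ∀ (z : B7Prop1Explicit.Site (F.P K).d) (μ : Fin (F.P K).d),
      SideTouches (pullDom (fun i => {y : Site (F.P K) 0 | D.InOm i y}) j) z μ →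
      (Unitary.toUnits (u (transl 0 z)))⁻¹ * unitsField (toUField U) ⟨transl 0 z, μ⟩ * Unitary.toUnits (u ((transl 0 z).shift μ)) =
        expUnit (I • ((((F.L : ℝ)⁻¹) ^ (K - n)) • A ⟨transl 0 z, μ⟩)))
    {j : ℕ} (h1 : 1 ≤ j) (hjk : j ≤ K - n) (b : PBond (F.P K) 0) (hb : D.InOm j b.src) :
    expCfg (((F.L : ℝ)⁻¹) ^ (K - n)) A b = gaugeActT (fun s => (Unitary.toUnits (u s))⁻¹) (unitsField (toUField U)) b := by
  have h := hchart j h1 hjk (fun ν => ((b.src ν).val : ℤ)) b.dir (sideTouches_top_of_inOm D b hb)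
  rw [transl_zero_valLabels] at h
  rw [gaugeActT_apply, inv_inv]
  change expCfg (((F.L : ℝ)⁻¹) ^ (K - n)) A b = (Unitary.toUnits (u b.src))⁻¹ * unitsField (toUField U) ⟨b.src, b.dir⟩ * Unitary.toUnits (u (b.src.shift b.dir))
  rw [h]
  apply Units.ext
  rw [coe_expCfg, B7Prop1Explicit.val_expUnit, mul_smul, Complex.coe_smul]

/-- **LOCALITY AT THE TOP**: for a top bond `e` with both ends in the top cube, the `(K−n)`-fold double-bar average of `e^{iηA}` at `e` IS that of the gauge copy
`u⁻¹Uu` (the read set lies under the two top blocks of `e`, where (ii) identifies the two configurations).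
[cite: Balaban1985Averaging, (127) p.36, (150) p.40; Balaban1985Variational, (152) p.301, (156) p.302] -/
theorem dbarIterU_expCfg_eq_gaugeCopy_top (hnK : n < K) (D : Domains (F.P K)) {U : GaugeField (F.P K) 0 (Matrix.specialUnitaryGroup (Fin 2) ℂ)}
    {u : GaugeTransf (F.P K) 0 (Matrix.unitaryGroup (Fin 2) ℂ)} {A : PBond (F.P K) 0 → Matrix (Fin 2) (Fin 2) ℂ}
    (hchart : ∀ j, 1 ≤ j → j ≤ K - n → ∀ (z : B7Prop1Explicit.Site (F.P K).d) (μ : Fin (F.P K).d),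
      SideTouches (pullDom (fun i => {y : Site (F.P K) 0 | D.InOm i y}) j) z μ →
      (Unitary.toUnits (u (transl 0 z)))⁻¹ * unitsField (toUField U) ⟨transl 0 z, μ⟩ * Unitary.toUnits (u ((transl 0 z).shift μ)) =
        expUnit (I • ((((F.L : ℝ)⁻¹) ^ (K - n)) • A ⟨transl 0 z, μ⟩)))
    (e : PBond (F.P K) (K - n)) (hsrc : e.src ∈ D.Om (K - n)) (htgt : e.tgt ∈ D.Om (K - n)) :
    dbarIterU (K - n) (expCfg (((F.L : ℝ)⁻¹) ^ (K - n)) A) e =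
      dbarIterU (K - n) (gaugeActT (fun s => (Unitary.toUnits (u s))⁻¹) (unitsField (toUField U))) e := by
  refine dbarIterU_congr_of_agree (K - n) (FlatMinimizerH.le_T3 F n K) e fun b hbs _ => ?_
  refine expCfg_eq_gaugeCopy_of_chart D hchart (by omega) le_rfl b ?_
  show iterBlockOf (K - n) b.src ∈ D.Om (K - n)
  rcases hbs with h | h
  · rw [h]; exact hsrc
  · rw [h]; exact htgt

end Locality

/-! ## §2 (vi): the (160)♭ near size of the top chart datum, from (o) + (ii) -/

section Near

/-- the inner radius of the aligned cube sequence at its own top level is `ρ`. [cite: Balaban1985Variational, (144) p.300] -/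
theorem radM_zero (L M ρ S : ℕ) : radM L M ρ S 0 = ρ := rfl

/-- **A TOP SITE OF THE TOP CUBE IS WITHIN `ρ + M − 1` OF THE CENTRE BLOCK** (`1 ≤ K − n`). [cite: Balaban1985Variational, (144) p.300] -/
theorem dist_le_of_mem_top (hnK : n < K) (x : Site (F.P K) 0) (ρ S M : ℕ) (hM : 1 ≤ M) {y : Site (F.P K) (K - n)}
    (hy : y ∈ (cubeSeqMT3 F n K x ρ S M hM).Om (K - n)) :
    distSite (Mk (F.P K) (K - n)) y (iterBlockOf (K - n) x) ≤ (ρ : ℝ) + ((M : ℝ) - 1) := by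
  change y ∈ (cubeSeqM x (K - n) (FlatMinimizerH.le_T3 F n K) ρ S M hM).Om (K - n) at hy
  rw [cubeSeqM_Om_pos x (FlatMinimizerH.le_T3 F n K) ρ S M hM (by omega) le_rfl] at hy
  have h := dist_le_of_mem_cubeFinM hM hy
  rwa [Nat.sub_self, radM_zero] at h

/-- ★ **(vi) FROM (o) + (ii)** — the (160)♭ near row in the `hnear` currency with the bare `chartLogFlat`: for `U ∈ 𝔅_k(V)` over a (7)-datum `V` (`PlaqSmall ε₁ V`,
`0 ≤ ε₁`), the chart identity (ii) and the D-P1 clause (o) for `(u, A)`, and the regime `12(ρ + M)ε₁ ≤ 1`: at every top index bond of the cube sequence with both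
ends in the top cube, `‖chartLogFlat η D A c‖ ≤ 6ε₁(dist(c₋, Bᵏx) + 1)`.
[cite: Balaban1985Variational, (154)-(156) p.302, (160) p.303; Balaban1985UV3, (27)-(28) p.263] -/
theorem near160_of_core (hnK : n < K) (x : Site (F.P K) 0) (ρ S M : ℕ) (hM : 1 ≤ M) {ε₁ : ℝ} (hε₁ : 0 ≤ ε₁)
    (hreg : 12 * ((ρ : ℝ) + (M : ℝ)) * ε₁ ≤ 1)
    {V : GaugeField (F.P n) 0 (Matrix.specialUnitaryGroup (Fin 2) ℂ)} {U : GaugeField (F.P K) 0 (Matrix.specialUnitaryGroup (Fin 2) ℂ)}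
    (hU : U ∈ fibre F ℰp n K hnK.le V) (hV : PlaqSmall ε₁ V)
    {u : GaugeTransf (F.P K) 0 (Matrix.unitaryGroup (Fin 2) ℂ)} {A : PBond (F.P K) 0 → Matrix (Fin 2) (Fin 2) ℂ}
    (ho : DP1Clause F n K (cubeSeqMT3 F n K x ρ S M hM) x U u)
    (hchart : ∀ j, 1 ≤ j → j ≤ K - n → ∀ (z : B7Prop1Explicit.Site (F.P K).d) (μ : Fin (F.P K).d),
      SideTouches (pullDom (fun i => {y : Site (F.P K) 0 | (cubeSeqMT3 F n K x ρ S M hM).InOm i y}) j) z μ →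
      (Unitary.toUnits (u (transl 0 z)))⁻¹ * unitsField (toUField U) ⟨transl 0 z, μ⟩ * Unitary.toUnits (u ((transl 0 z).shift μ)) =
        expUnit (I • ((((F.L : ℝ)⁻¹) ^ (K - n)) • A ⟨transl 0 z, μ⟩))) :
    ∀ c : BondIdx (cubeSeqMT3 F n K x ρ S M hM), (c.1.1 : ℕ) = K - n →
      c.1.2.src ∈ (cubeSeqMT3 F n K x ρ S M hM).Om (c.1.1 : ℕ) → c.1.2.tgt ∈ (cubeSeqMT3 F n K x ρ S M hM).Om (c.1.1 : ℕ) →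
      ‖chartLogFlat (((F.L : ℝ)⁻¹) ^ (K - n)) (cubeSeqMT3 F n K x ρ S M hM) A c‖ ≤
        6 * ε₁ * (distSite (Mk (F.P K) (c.1.1 : ℕ)) c.1.2.src (iterBlockOf (c.1.1 : ℕ) x) + 1) := by
  -- the statement at a top bond of a general level `j = K − n` (so that no cast is needed)
  have key : ∀ (j : ℕ) (hj : j = K - n) (e : PBond (F.P K) j), e.src ∈ (cubeSeqMT3 F n K x ρ S M hM).Om j →
      e.tgt ∈ (cubeSeqMT3 F n K x ρ S M hM).Om j →
      ‖(-I) • mlog ((dbarIterU j (expCfg (((F.L : ℝ)⁻¹) ^ (K - n)) A) e : (Matrix (Fin 2) (Fin 2) ℂ)ˣ) : Matrix (Fin 2) (Fin 2) ℂ)‖ ≤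
        6 * ε₁ * (distSite (Mk (F.P K) j) e.src (iterBlockOf j x) + 1) := by
    intro j hj e hsrc htgt
    subst hj
    rw [dbarIterU_expCfg_eq_gaugeCopy_top hnK _ hchart e hsrc htgt, ho e hsrc htgt, ← B27T_eq]
    have hdist := dist_le_of_mem_top hnK x ρ S M hM hsrc
    have hd0 : 0 ≤ distSite (Mk (F.P K) (K - n)) e.src (iterBlockOf (K - n) x) := distSite_nonneg _ _
    have hsmall : 6 * distSite (Mk (F.P K) (K - n)) e.src (iterBlockOf (K - n) x) * ε₁ ≤ 1 / 2 := by nlinarith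
    have h := (HalvingDatum160.norm_datum160_le F hnK.le hε₁ hU hV (iterBlockOf (K - n) x) e hsmall).1
    nlinarith
  intro c hc hsrc htgt
  rw [chartLogFlat_apply]
  exact key (c.1.1 : ℕ) hc c.1.2 hsrc htgt

end Near

/-! ## §3 (vii): every chart datum is `O(ε₀)`, from the first member of (iii) -/

section Far

/-- ★ **(vii) FROM (iii)₁** — the (155)∕(1.37)♭ global datum size: if `w 1 b‖A b‖ ≤ B₁ε₀` at the level weights of the cube sequence (`R′M ≤ S`, `2L ≤ R′M + 1`,
`0 < ε₀`, regime `60800·((d+2)L)²·L·(B₁+1)ε₀ ≤ 1`), then `‖chartLogFlat η D A c‖ ≤ 8L(B₁ + 1)ε₀` at EVERY index bond (the k-uniform sup letter of the ♭ chart on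
the `w 1`-ball of radius `(B₁+1)ε₀`). [cite: Balaban1985Variational, (155) p.302, (44)-(47) p.285; Balaban1985RegularSpaces, (1.37) p.82] -/
theorem far155_of_size152 (x : Site (F.P K) 0) (ρ S M : ℕ) (hM : 1 ≤ M) {R' : ℕ} (hRS : R' * M ≤ S) (hRM : 2 * (F.P K).L ≤ R' * M + 1)
    {ε₀ B₁ : ℝ} (hε₀ : 0 < ε₀)
    (hreg : 16 * 3800 * ((((F.P K).d + 2) * (F.P K).L : ℕ) : ℝ) ^ 2 * (F.L : ℝ) * ((B₁ + 1) * ε₀) ≤ 1)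
    {A : PBond (F.P K) 0 → Matrix (Fin 2) (Fin 2) ℂ}
    (hsize : ∀ w : ℕ → PBond (F.P K) 0 → ℝ, IsLevWeight F n K (cubeSeqMT3 F n K x ρ S M hM) w →
      ∀ b : PBond (F.P K) 0, w 1 b * ‖A b‖ ≤ B₁ * ε₀) :
    ∀ c : BondIdx (cubeSeqMT3 F n K x ρ S M hM), ‖chartLogFlat (((F.L : ℝ)⁻¹) ^ (K - n)) (cubeSeqMT3 F n K x ρ S M hM) A c‖ ≤
      8 * (F.L : ℝ) * (B₁ + 1) * ε₀ := by
  -- the canonical level weights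
  have hw : IsLevWeight F n K (cubeSeqMT3 F n K x ρ S M hM)
      (fun m b => ((F.L : ℝ) ^ levOf (fun j => {y : Site (F.P K) 0 | (cubeSeqMT3 F n K x ρ S M hM).InOm j y}) (K - n) b.src *
        ((F.L : ℝ)⁻¹) ^ (K - n)) ^ m) := fun _ _ => rfl
  have hball : ∀ b : PBond (F.P K) 0,
      ((F.L : ℝ) ^ levOf (fun j => {y : Site (F.P K) 0 | (cubeSeqMT3 F n K x ρ S M hM).InOm j y}) (K - n) b.src *
        ((F.L : ℝ)⁻¹) ^ (K - n)) ^ 1 * ‖A b‖ < (B₁ + 1) * ε₀ := by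
    intro b
    have h := hsize _ hw b
    have : B₁ * ε₀ < (B₁ + 1) * ε₀ := by nlinarith
    exact lt_of_le_of_lt h this
  have h := (chartLogFlat_hCd_sup_of_adm22 F n K (cubeSeqMT3 F n K x ρ S M hM) rfl (adm22_cubeSeqMT3 F n K x ρ hM hRS) hRM hw hreg).2 hball
  intro c
  have hc := h c
  linarith

end Far

/-! ## §4 The pillar from its core -/

section Core

/-- ★★ **`P1FlatPillarAt` FROM ITS CORE** — the TYPED RESIDUE of pillar P1♭ (programme row WANTED №g26-5 «Thm 2♭ on T³»): given the cube data (`R′M ≤ S`,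
`2L ≤ R′M + 1`), `U ∈ 𝔅_k(V)` over a (7)-datum (`PlaqSmall ε₁ V`), `0 ≤ ε₁`, `0 < ε₀`, the regimes `12(ρ+M)ε₁ ≤ 1` and `60800·((d+2)L)²·L·(B₁+1)ε₀ ≤ 1`, and the CORE
`∃ u A, (o) DP1Clause ∧ (i) sa∕tr ∧ (ii) chart identity on the member ∧ (iii) (1.36)♭ sizes ∧ (iv) Landau multiplier form` (VERBATIM the first five conjunct groups of
`P1FlatPillarAt`), the pillar holds with `C₁ = 6`, `C₂ = 8L(B₁ + 1)`.
[cite: Balaban1985RegularSpaces, Thm 2 p.83, (1.36)-(1.38) p.82; Balaban1985Variational, (152)-(156) pp.301-302, (160) p.303] -/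
theorem p1FlatPillarAt_of_core (hnK : n < K) (x : Site (F.P K) 0) (ρ S M : ℕ) (hM : 1 ≤ M) {R' : ℕ} (hRS : R' * M ≤ S)
    (hRM : 2 * (F.P K).L ≤ R' * M + 1) {ε₀ ε₁ B₁ : ℝ} (hε₁ : 0 ≤ ε₁) (hε₀ : 0 < ε₀)
    (hreg₁ : 12 * ((ρ : ℝ) + (M : ℝ)) * ε₁ ≤ 1)
    (hreg₀ : 16 * 3800 * ((((F.P K).d + 2) * (F.P K).L : ℕ) : ℝ) ^ 2 * (F.L : ℝ) * ((B₁ + 1) * ε₀) ≤ 1)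
    {V : GaugeField (F.P n) 0 (Matrix.specialUnitaryGroup (Fin 2) ℂ)} {U : GaugeField (F.P K) 0 (Matrix.specialUnitaryGroup (Fin 2) ℂ)}
    (hU : U ∈ fibre F ℰp n K hnK.le V) (hV : PlaqSmall ε₁ V)
    (core : ∃ (u : GaugeTransf (F.P K) 0 (Matrix.unitaryGroup (Fin 2) ℂ)) (A : PBond (F.P K) 0 → Matrix (Fin 2) (Fin 2) ℂ),
      DP1Clause F n K (cubeSeqMT3 F n K x ρ S M hM) x U u ∧
      (∀ b : PBond (F.P K) 0, IsSelfAdjoint (A b)) ∧ (∀ b : PBond (F.P K) 0, Matrix.trace (A b) = 0) ∧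
      (∀ j, 1 ≤ j → j ≤ K - n → ∀ (z : B7Prop1Explicit.Site (F.P K).d) (μ : Fin (F.P K).d),
        SideTouches (pullDom (fun i => {y : Site (F.P K) 0 | (cubeSeqMT3 F n K x ρ S M hM).InOm i y}) j) z μ →
        (Unitary.toUnits (u (transl 0 z)))⁻¹ * unitsField (toUField U) ⟨transl 0 z, μ⟩ * Unitary.toUnits (u ((transl 0 z).shift μ)) =
          expUnit (I • ((((F.L : ℝ)⁻¹) ^ (K - n)) • A ⟨transl 0 z, μ⟩))) ∧
      (∀ w : ℕ → PBond (F.P K) 0 → ℝ, IsLevWeight F n K (cubeSeqMT3 F n K x ρ S M hM) w →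
        (∀ b : PBond (F.P K) 0, w 1 b * ‖A b‖ ≤ B₁ * ε₀) ∧
        (∀ (b : PBond (F.P K) 0) (ν : Fin (F.P K).d), w 2 b * (F.L : ℝ) ^ (K - n) * ‖A ⟨b.src.shift ν, b.dir⟩ - A b‖ ≤ B₁ * ε₀)) ∧
      (∃ μ : SiteIdx (cubeSeqMT3 F n K x ρ S M hM) → Matrix (Fin 2) (Fin 2) ℂ, ∀ s : Site (F.P K) 0,
        laplace ((F.L : ℝ) ^ (K - n)) (diverg ((F.L : ℝ) ^ (K - n)) A) s =
          ∑ i : SiteIdx (cubeSeqMT3 F n K x ρ S M hM), siteAvgIter (i.1.1 : ℕ) (Pi.single s (1 : ℝ)) i.1.2 • μ i)) :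
    P1FlatPillarAt F n K (cubeSeqMT3 F n K x ρ S M hM) x ε₀ ε₁ B₁ 6 (8 * (F.L : ℝ) * (B₁ + 1)) U := by
  obtain ⟨u, A, ho, hsa, htr, hchart, hsize, hslice⟩ := core
  refine ⟨u, A, ho, hsa, htr, hchart, hsize, hslice, near160_of_core hnK x ρ S M hM hε₁ hreg₁ hU hV ho hchart, fun c => ?_⟩
  have h := far155_of_size152 x ρ S M hM hRS hRM hε₀ hreg₀ (fun w hw => (hsize w hw).1) c
  linarith

end Core

end Summit.QuantumFields.YangMills.Theorems.HalvingP1FlatPillarRows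


/-! ## §5 The pillar `P1FlatPillar` from the core at every site (v1.1, append-only) -/

namespace Summit.QuantumFields.YangMills.Theorems.HalvingP1FlatPillarRows

open Literature.MathematicalPhysics.QuantumFieldTheory.Balaban1983to89
open Literature.MathematicalPhysics.QuantumFieldTheory.Balaban1983to89.T3ContinuumYM3Torus
open Literature.MathematicalPhysics.QuantumFieldTheory.Balaban1983to89.T3PrintedRegularMinimiser
open Literature.MathematicalPhysics.QuantumFieldTheory.Balaban1983to89.T3Thm1Carrier
open Complex (I)
open B6SectADomainsV1 (Domains)
open B6SectAOperatorsV1 (SiteIdx)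
open B7Prop1Explicit (expUnit)
open B8Eq140Level (SideTouches)
open B8Thm2SetupTorus (pullDom)
open B10Eq27TorusAxialLog (transl unitsField toUField)
open LatticeFieldCalculus (laplace diverg siteAvgIter)
open FlatCubeOpsText (IsLevWeight)
open FlatCubeSequenceAligned (cubeSeqMT3)
open HalvingP1FlatPillar (DP1Clause P1FlatPillarAt P1FlatPillar)

section Outer

/-- ★★ **`P1FlatPillar` FROM THE CORE AT EVERY SITE** — the outer knit: for constants with `0 < Cr`, `12(ρ + M)·a ≤ Cr` (so that `Cr·ε₁ ≤ ε₀ ≤ a` gives the near regime)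
and `60800·(5L)²·L·(B₁ + 1)·a ≤ 1` (the far regime), cube data `R′M ≤ S`, `2L ≤ R′M + 1`, the CORE at every member∕site (VERBATIM the first five conjunct groups of
`P1FlatPillarAt`, = WANTED №g26-5 as a typed hypothesis) gives the pillar `P1FlatPillar L ρ S M hM a Cr B₁ 6 (8L(B₁+1))`.
[cite: Balaban1985RegularSpaces, Thm 2 p.83, (1.36)-(1.38) p.82; Balaban1985Variational, Prop 2 p.281, (152)-(156) pp.301-302, (160) p.303] -/
theorem p1FlatPillar_of_core (L ρ S M : ℕ) (hM : 1 ≤ M) {R' : ℕ} (hRS : R' * M ≤ S) (hRM : 2 * L ≤ R' * M + 1) {a Cr B₁ : ℝ}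
    (hCr : 0 < Cr) (hreg₁ : 12 * ((ρ : ℝ) + (M : ℝ)) * a ≤ Cr) (hreg₀ : 16 * 3800 * ((5 * L : ℕ) : ℝ) ^ 2 * (L : ℝ) * ((B₁ + 1) * a) ≤ 1) (hB₁ : 0 ≤ B₁ + 1)
    (core : ∀ F : T3Family, F.L = L → ∀ (n K : ℕ) (hnK : n < K) (ε₀ ε₁ : ℝ), 0 < ε₁ → 0 < ε₀ → ε₀ ≤ a → Cr * ε₁ ≤ ε₀ →
      ∀ V : GaugeField (F.P n) 0 (Matrix.specialUnitaryGroup (Fin 2) ℂ), PlaqSmall ε₁ V →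
        ∀ U ∈ regFibrePr F n K hnK.le ε₀ V, ∀ x : Site (F.P K) 0,
          ∃ (u : GaugeTransf (F.P K) 0 (Matrix.unitaryGroup (Fin 2) ℂ)) (A : PBond (F.P K) 0 → Matrix (Fin 2) (Fin 2) ℂ),
            DP1Clause F n K (cubeSeqMT3 F n K x ρ S M hM) x U u ∧
            (∀ b : PBond (F.P K) 0, IsSelfAdjoint (A b)) ∧ (∀ b : PBond (F.P K) 0, Matrix.trace (A b) = 0) ∧
            (∀ j, 1 ≤ j → j ≤ K - n → ∀ (z : B7Prop1Explicit.Site (F.P K).d) (μ : Fin (F.P K).d),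
              SideTouches (pullDom (fun i => {y : Site (F.P K) 0 | (cubeSeqMT3 F n K x ρ S M hM).InOm i y}) j) z μ →
              (Unitary.toUnits (u (transl 0 z)))⁻¹ * unitsField (toUField U) ⟨transl 0 z, μ⟩ * Unitary.toUnits (u ((transl 0 z).shift μ)) =
                expUnit (I • ((((F.L : ℝ)⁻¹) ^ (K - n)) • A ⟨transl 0 z, μ⟩))) ∧
            (∀ w : ℕ → PBond (F.P K) 0 → ℝ, IsLevWeight F n K (cubeSeqMT3 F n K x ρ S M hM) w →
              (∀ b : PBond (F.P K) 0, w 1 b * ‖A b‖ ≤ B₁ * ε₀) ∧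
              (∀ (b : PBond (F.P K) 0) (ν : Fin (F.P K).d), w 2 b * (F.L : ℝ) ^ (K - n) * ‖A ⟨b.src.shift ν, b.dir⟩ - A b‖ ≤ B₁ * ε₀)) ∧
            (∃ μ : SiteIdx (cubeSeqMT3 F n K x ρ S M hM) → Matrix (Fin 2) (Fin 2) ℂ, ∀ s : Site (F.P K) 0,
              laplace ((F.L : ℝ) ^ (K - n)) (diverg ((F.L : ℝ) ^ (K - n)) A) s =
                ∑ i : SiteIdx (cubeSeqMT3 F n K x ρ S M hM), siteAvgIter (i.1.1 : ℕ) (Pi.single s (1 : ℝ)) i.1.2 • μ i)) :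
    P1FlatPillar L ρ S M hM a Cr B₁ 6 (8 * (L : ℝ) * (B₁ + 1)) := by
  intro F hF n K hnK ε₀ ε₁ hε₁ hε₀ hε₀a hCrε V hV U hU x
  have hfib := ((mem_regFibrePr_iff F).1 hU).1
  -- the two regimes from `Cr·ε₁ ≤ ε₀ ≤ a`
  have hρM : 0 ≤ (ρ : ℝ) + (M : ℝ) := by positivity
  have hε₁a : Cr * ε₁ ≤ a := hCrε.trans hε₀a
  have h1 : 12 * ((ρ : ℝ) + (M : ℝ)) * ε₁ ≤ 1 := by
    have h12 : 12 * ((ρ : ℝ) + (M : ℝ)) * (Cr * ε₁) ≤ Cr * 1 := by nlinarith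
    have : 12 * ((ρ : ℝ) + (M : ℝ)) * ε₁ * Cr ≤ 1 * Cr := by nlinarith
    exact le_of_mul_le_mul_right this hCr
  have hL : ((((F.P K).d + 2) * (F.P K).L : ℕ) : ℝ) = ((5 * L : ℕ) : ℝ) := by
    rw [T3Family.P_d, show (F.P K).L = F.L from rfl, hF]
  have h0 : 16 * 3800 * ((((F.P K).d + 2) * (F.P K).L : ℕ) : ℝ) ^ 2 * (F.L : ℝ) * ((B₁ + 1) * ε₀) ≤ 1 := by
    rw [hL, hF]
    have hc : 0 ≤ 16 * 3800 * ((5 * L : ℕ) : ℝ) ^ 2 * (L : ℝ) * (B₁ + 1) := by positivity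
    calc 16 * 3800 * ((5 * L : ℕ) : ℝ) ^ 2 * (L : ℝ) * ((B₁ + 1) * ε₀)
        = 16 * 3800 * ((5 * L : ℕ) : ℝ) ^ 2 * (L : ℝ) * (B₁ + 1) * ε₀ := by ring
      _ ≤ 16 * 3800 * ((5 * L : ℕ) : ℝ) ^ 2 * (L : ℝ) * (B₁ + 1) * a := mul_le_mul_of_nonneg_left hε₀a hc
      _ = 16 * 3800 * ((5 * L : ℕ) : ℝ) ^ 2 * (L : ℝ) * ((B₁ + 1) * a) := by ring
      _ ≤ 1 := hreg₀
  have hRM' : 2 * (F.P K).L ≤ R' * M + 1 := by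
    rw [show (F.P K).L = F.L from rfl, hF]; exact hRM
  have h := p1FlatPillarAt_of_core hnK x ρ S M hM hRS hRM' hε₁.le hε₀ h1 h0 hfib hV
    (core F hF n K hnK ε₀ ε₁ hε₁ hε₀ hε₀a hCrε V hV U hU x)
  have hFL : (8 * (F.L : ℝ) * (B₁ + 1)) = 8 * (L : ℝ) * (B₁ + 1) := by rw [hF]
  rw [hFL] at h
  exact h

end Outer

end Summit.QuantumFields.YangMills.Theorems.HalvingP1FlatPillarRows

end
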